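import Mathlib
import Summits.PneNP.PneNP.Theorems.ConvexRankGatesLinAlgGateBlindWideApproxHost
import Summits.PneNP.PneNP.Theorems.ConvexRankGatesLinAlgGateBlindDenseRegimeAux

/-!
# Route ConvexRankGates, crux `LinAlgGateBlind` (stmt-PneNP-10681): semantic Alon–Boppana layers (supports)

Generic lemmas for running Razborov's approximation method (Alon–Boppana 1987, Thm. 2.1, in the lattice
`K(m, r, l)` of closed families, one-sided errors on bare `k`-cliques × `G(m, q)`) along a monotone
computation given SEMANTICALLY — as a family of Boolean functions of the graph built in LAYERS of
`Σ Π`-steps (an OR of ANDs of functions of the previous layer) — rather than along a gate list. Every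
function of a layer shares ONE finset `BadP` of lost `k`-sets and ONE event `BadN` of gained graphs
(the wire invariant of `Theorems/ConvexRankGatesLinAlgGateBlindWideApproxHost.lean`, reused verbatim:
`inv_mono`, `inv_and`), so that SHARED sub-results are charged once: this is what makes dynamic-programming
computations such as Bellman–Ford reachability (file `…TranspositionDoor.lean`) polynomially cheap.

* `inv_atomOr` — an OR of clique atoms `⌈𝓗⌉`, `𝓗 ⊆ 𝒱(l)` of ANY fan-in, is approximated by `𝓗*` at the
  price of ONE plucking event `⌈𝓗*⌉ ∧ ¬⌈𝓗⌉` and no lost clique;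
* `inv_sigmaPi` — a `Σ Π`-step `u = v₀ ∨ ⋁_{i ∈ R} (aᵢ ∧ bᵢ)` over functions carrying the invariant is
  approximated by `(F₀ ∪ ⋃ᵢ Aᵢ ∩ Bᵢ)*` at the price of the trimming sets `errPos k Aᵢ Bᵢ` and one plucking event;
* `inv_bigAnd` — an AND of finitely many functions carrying the invariant (iterated `inv_and`);
* `isClosedFamily_empty'` (`∅ ∈ K(m,r,l)` for `r ≥ 1`);
* graph/group facts for the transposition door: `exists_walk_length_le_succ_iff` (the Bellman–Ford
  recursion on walks of bounded length), `reachable_apply_of_mem_closure` /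
  `mem_orbit_closure_of_reachable` (orbits of a group generated by transpositions along the edges of a
  graph are unions of connected components; cf. Mathlib `mem_closure_isSwap`), and the resulting
  characterisation `mem_closure_image_iff_forall_reachable` of TRANSPOSITION DESIGNS (PERM gates whose
  generators are transpositions) as switching networks: membership = componentwise reachability;
* the budget arithmetic `two_mul_pow_mul_epsOf_le` (`2 m^{4c} ε_{5c+1}(m) ≤ ε_c(m)`), `pow_four_add_le`.

Sources: A. A. Razborov (1985); N. Alon, R. B. Boppana, Combinatorica 7 (1987) Thm. 2.1, §3; R. Bellman (1958).
No definitions, nothing is assumed. [folklore]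
-/

-- `Summit.PneNP.PneNP.…` duplicates `PneNP` BY DESIGN (single-problem summit).
set_option linter.dupNamespace false

noncomputable section

namespace Summit.PneNP.PneNP.Theorems

open Finset Literature.Computability.Complexity Razborov
open Summit.PneNP.PneNP.Cruxes.LinAlgGateBlind.DnfInvariantWideGatesSeeSmallCliques

/-! ### Closed families: the bottom element -/

/-- The empty family is closed as soon as `r ≥ 1` (an implication needs `r` members). [folklore] -/
theorem isClosedFamily_empty' {α : Type*} [DecidableEq α] [Fintype α] {r : ℕ} (hr : 0 < r) (l : ℕ) :
    IsClosedFamily r l (∅ : Finset (Finset α)) :=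
  ⟨empty_subset _, fun _ _ hI => by
    obtain ⟨W, hW, -⟩ := hI
    exact absurd (hW ⟨0, hr⟩) (notMem_empty _)⟩

/-! ### Semantic layers of the approximation method -/

section Layer

variable {m r l k : ℕ}

/-- **An OR of atoms of any fan-in costs one pluck.** For `𝓗 ⊆ 𝒱(l)` and a Boolean function `E` with
`E = ⌈𝓗⌉`, the closure `𝓗*` carries the wire invariant with no lost clique, off the single plucking event
`⌈𝓗*⌉ ∧ ¬⌈𝓗⌉` (Alon–Boppana 1987, Lemma 3.7 applied once to the whole family). [folklore] -/
theorem inv_atomOr {𝓗 : Finset (Finset (Fin m))} (h𝓗 : 𝓗 ⊆ smallSets (Fin m) l)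
    {E : (KEdge m → Bool) → Bool} (hE : ∀ x, E x = true ↔ Accepts 𝓗 x)
    (BadP : Finset (Finset (Fin m))) {BadN : (KEdge m → Bool) → Prop}
    (hN : ∀ x, Accepts (closure r l 𝓗) x ∧ ¬ Accepts 𝓗 x → BadN x) :
    IsClosedFamily r l (closure r l 𝓗) ∧
      (∀ x : KEdge m → Bool, ¬ BadN x → Accepts (closure r l 𝓗) x → E x = true) ∧
      ∀ S : Finset (Fin m), #S = k → E (cliqueVec S) = true →
        Accepts (closure r l 𝓗) (cliqueVec S) ∨ S ∈ BadP := by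
  refine ⟨isClosedFamily_closure r l 𝓗, fun x hx hacc => ?_, fun S _ hS => ?_⟩
  · by_contra hE'
    exact hx (hN x ⟨hacc, fun h => hE' ((hE x).2 h)⟩)
  · exact Or.inl (((hE _).1 hS).mono (subset_closure h𝓗))

/-- **A `Σ Π`-step costs its trimming sets and one pluck.** If `v₀` and all `aᵢ, bᵢ` (`i ∈ R`) carry the
wire invariant with closed families `F₀, Aᵢ, Bᵢ` and common error collectors `BadP, BadN`, and
`u = v₀ ∨ ⋁_{i ∈ R} (aᵢ ∧ bᵢ)`, then `u` carries it with the closed family `(F₀ ∪ ⋃ᵢ (Aᵢ ∩ Bᵢ))*` and any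
collectors containing `BadP ∪ ⋃ᵢ errPos k Aᵢ Bᵢ` and `BadN ∨ (⌈𝒞*⌉ ∧ ¬⌈𝒞⌉)` (Alon–Boppana 1987, Thm. 2.1:
the meets of Lemma 3.1 lose `errPos`, the join is re-closed once). [folklore] -/
theorem inv_sigmaPi {ι : Type*} (R : Finset ι)
    {a b : ι → (KEdge m → Bool) → Bool} {A B : ι → Finset (Finset (Fin m))}
    {F₀ : Finset (Finset (Fin m))} {v₀ u : (KEdge m → Bool) → Bool}
    {BadP BadP' : Finset (Finset (Fin m))} {BadN BadN' : (KEdge m → Bool) → Prop}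
    (h₀ : IsClosedFamily r l F₀ ∧ (∀ x : KEdge m → Bool, ¬ BadN x → Accepts F₀ x → v₀ x = true) ∧
      ∀ S : Finset (Fin m), #S = k → v₀ (cliqueVec S) = true → Accepts F₀ (cliqueVec S) ∨ S ∈ BadP)
    (ha : ∀ i ∈ R, IsClosedFamily r l (A i) ∧
      (∀ x : KEdge m → Bool, ¬ BadN x → Accepts (A i) x → a i x = true) ∧
      ∀ S : Finset (Fin m), #S = k → a i (cliqueVec S) = true → Accepts (A i) (cliqueVec S) ∨ S ∈ BadP)
    (hb : ∀ i ∈ R, IsClosedFamily r l (B i) ∧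
      (∀ x : KEdge m → Bool, ¬ BadN x → Accepts (B i) x → b i x = true) ∧
      ∀ S : Finset (Fin m), #S = k → b i (cliqueVec S) = true → Accepts (B i) (cliqueVec S) ∨ S ∈ BadP)
    (hu : ∀ x, u x = true ↔ v₀ x = true ∨ ∃ i ∈ R, a i x = true ∧ b i x = true)
    (hP : BadP ⊆ BadP') (hPerr : ∀ i ∈ R, errPos k (A i) (B i) ⊆ BadP')
    (hNN : ∀ x, BadN x → BadN' x)
    (hNpl : ∀ x, Accepts (closure r l (F₀ ∪ R.biUnion fun i => A i ∩ B i)) x ∧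
      ¬ Accepts (F₀ ∪ R.biUnion fun i => A i ∩ B i) x → BadN' x) :
    IsClosedFamily r l (closure r l (F₀ ∪ R.biUnion fun i => A i ∩ B i)) ∧
      (∀ x : KEdge m → Bool, ¬ BadN' x →
        Accepts (closure r l (F₀ ∪ R.biUnion fun i => A i ∩ B i)) x → u x = true) ∧
      ∀ S : Finset (Fin m), #S = k → u (cliqueVec S) = true →
        Accepts (closure r l (F₀ ∪ R.biUnion fun i => A i ∩ B i)) (cliqueVec S) ∨ S ∈ BadP' := by
  classical
  set 𝒞 := F₀ ∪ R.biUnion fun i => A i ∩ B i with h𝒞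
  have hsub : 𝒞 ⊆ smallSets (Fin m) l := by
    refine union_subset h₀.1.subset (biUnion_subset.2 fun i hi => ?_)
    exact inter_subset_left.trans (ha i hi).1.subset
  refine ⟨isClosedFamily_closure r l 𝒞, fun x hx hacc => ?_, fun S hS hv => ?_⟩
  · have hN : ¬ BadN x := fun h => hx (hNN x h)
    have h𝒞acc : Accepts 𝒞 x := by
      by_contra h
      exact hx (hNpl x ⟨hacc, h⟩)
    obtain ⟨W, hW, hWx⟩ := h𝒞acc
    rw [hu]
    rcases mem_union.1 hW with hW0 | hW1
    · exact Or.inl (h₀.2.1 x hN ⟨W, hW0, hWx⟩)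
    · obtain ⟨i, hi, hWi⟩ := mem_biUnion.1 hW1
      exact Or.inr ⟨i, hi, (ha i hi).2.1 x hN ⟨W, (mem_inter.1 hWi).1, hWx⟩,
        (hb i hi).2.1 x hN ⟨W, (mem_inter.1 hWi).2, hWx⟩⟩
  · rcases (hu _).1 hv with hv0 | ⟨i, hi, hai, hbi⟩
    · rcases h₀.2.2 S hS hv0 with hacc | hbad
      · exact Or.inl ((hacc.mono subset_union_left).mono (subset_closure hsub))
      · exact Or.inr (hP hbad)
    · rcases (ha i hi).2.2 S hS hai with hA | hbad
      · rcases (hb i hi).2.2 S hS hbi with hB | hbad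
        · by_cases hAB : Accepts (A i ∩ B i) (cliqueVec S)
          · refine Or.inl ((hAB.mono ?_).mono (subset_closure hsub))
            exact (subset_biUnion_of_mem (fun i => A i ∩ B i) hi).trans subset_union_right
          · exact Or.inr (hPerr i hi (mem_errPos.2 ⟨hS, hA, hB, hAB⟩))
        · exact Or.inr (hP hbad)
      · exact Or.inr (hP hbad)

/-- **An AND of finitely many approximated functions** (iterated `inv_and`): if every `vᵢ`, `i ∈ s`,
carries the wire invariant with a closed family `Fᵢ` and common collectors, and every trimming set of two
closed families has at most `T` members, then `⋀_{i ∈ s} vᵢ` carries it with some closed family, the same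
gained event, and at most `|s| · T` further lost `k`-sets. [folklore] -/
theorem inv_bigAnd {ι : Type*} [DecidableEq ι] (T : ℕ)
    (hT : ∀ A B : Finset (Finset (Fin m)), IsClosedFamily r l A → IsClosedFamily r l B →
      #(errPos k A B) ≤ T)
    {v : ι → (KEdge m → Bool) → Bool} {F : ι → Finset (Finset (Fin m))}
    {BadP : Finset (Finset (Fin m))} {BadN : (KEdge m → Bool) → Prop} (s : Finset ι)
    (h : ∀ i ∈ s, IsClosedFamily r l (F i) ∧
      (∀ x : KEdge m → Bool, ¬ BadN x → Accepts (F i) x → v i x = true) ∧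
      ∀ S : Finset (Fin m), #S = k → v i (cliqueVec S) = true → Accepts (F i) (cliqueVec S) ∨ S ∈ BadP) :
    ∃ (G E : Finset (Finset (Fin m))), #E ≤ s.card * T ∧
      (IsClosedFamily r l G ∧
        (∀ x : KEdge m → Bool, ¬ BadN x → Accepts G x → decide (∀ i ∈ s, v i x = true) = true) ∧
        ∀ S : Finset (Fin m), #S = k → decide (∀ i ∈ s, v i (cliqueVec S) = true) = true →
          Accepts G (cliqueVec S) ∨ S ∈ BadP ∪ E) := by
  classical
  induction s using Finset.induction_on with
  | empty =>
    refine ⟨smallSets (Fin m) l, ∅, by simp, isClosedFamily_smallSets r l, fun x _ _ => by simp,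
      fun S _ _ => Or.inl ⟨∅, empty_mem_smallSets l, cliquePresent_empty _⟩⟩
  | insert i s hi ih =>
    obtain ⟨G, E, hE, hG⟩ := ih fun j hj => h j (mem_insert_of_mem hj)
    have hvi := inv_mono (h i (mem_insert_self i s)) (subset_union_left (s₂ := E)) (fun _ hx => hx)
      (fun _ => rfl)
    have hand := inv_and hG hvi
    refine ⟨G ∩ F i, E ∪ errPos k G (F i), ?_, ?_⟩
    · calc #(E ∪ errPos k G (F i)) ≤ #E + #(errPos k G (F i)) := card_union_le _ _
        _ ≤ s.card * T + T := Nat.add_le_add hE (hT G (F i) hG.1 (h i (mem_insert_self i s)).1)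
        _ = (insert i s).card * T := by rw [card_insert_of_notMem hi]; ring
    · refine inv_mono hand (fun S hS => ?_) (fun _ hx => hx) (fun x => ?_)
      · rcases mem_union.1 hS with hS | hS
        · rcases mem_union.1 hS with hS | hS
          · exact mem_union_left _ hS
          · exact mem_union_right _ (mem_union_left _ hS)
        · exact mem_union_right _ (mem_union_right _ hS)
      · simp only [forall_mem_insert, Bool.decide_and, Bool.decide_eq_true, Bool.and_comm]

end Layer

/-! ### Bounded-length walks (the Bellman–Ford recursion) -/

/-- **Bellman–Ford recursion.** A walk of length `≤ t + 1` from `a` to `b` is a walk of length `≤ t`, or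
a walk of length `≤ t` to a neighbour `c` of `b` followed by the edge `c b` (R. Bellman 1958). [folklore] -/
theorem exists_walk_length_le_succ_iff {V : Type*} {G : SimpleGraph V} {a b : V} {t : ℕ} :
    (∃ w : G.Walk a b, w.length ≤ t + 1) ↔
      (∃ w : G.Walk a b, w.length ≤ t) ∨ ∃ c, (∃ w : G.Walk a c, w.length ≤ t) ∧ G.Adj c b := by
  constructor
  · rintro ⟨w, hw⟩
    induction w using SimpleGraph.Walk.concatRec with
    | Hnil => exact Or.inl ⟨SimpleGraph.Walk.nil, by simp⟩
    | Hconcat p h _ =>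
      rw [SimpleGraph.Walk.length_concat] at hw
      exact Or.inr ⟨_, ⟨p, by omega⟩, h⟩
  · rintro (⟨w, hw⟩ | ⟨c, ⟨w, hw⟩, h⟩)
    · exact ⟨w, by omega⟩
    · exact ⟨w.concat h, by rw [SimpleGraph.Walk.length_concat]; omega⟩

/-- A reachable vertex of a finite graph is reached by a walk of length at most the number of vertices
(indeed by a path, of length `< |V|`). [folklore] -/
theorem exists_walk_length_le_card {V : Type*} [Fintype V] [DecidableEq V] {G : SimpleGraph V} {a b : V}
    (h : G.Reachable a b) : ∃ w : G.Walk a b, w.length ≤ Fintype.card V := by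
  obtain ⟨w⟩ := h
  exact ⟨w.bypass, (w.bypass_isPath.length_lt).le⟩

/-! ### Groups generated by transpositions along the edges of a graph -/

/-- If every generator is a transposition along an edge of `G`, every element of the generated group
moves each vertex inside its connected component (cf. Mathlib `mem_closure_isSwap`). [folklore] -/
theorem reachable_apply_of_mem_closure {V : Type*} [DecidableEq V] {G : SimpleGraph V}
    {S : Set (Equiv.Perm V)} (hS : ∀ f ∈ S, ∃ x y, G.Adj x y ∧ f = Equiv.swap x y) :
    ∀ f ∈ Subgroup.closure S, ∀ a : V, G.Reachable a (f a) := by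
  intro f hf
  induction hf using Subgroup.closure_induction with
  | mem f hf =>
    intro a
    obtain ⟨x, y, hxy, rfl⟩ := hS f hf
    by_cases hax : a = x
    · subst hax
      rw [Equiv.swap_apply_left]
      exact hxy.reachable
    by_cases hay : a = y
    · subst hay
      rw [Equiv.swap_apply_right]
      exact hxy.symm.reachable
    · rw [Equiv.swap_apply_of_ne_of_ne hax hay]
  | one => intro a; exact SimpleGraph.Reachable.refl a
  | mul f g _ _ hf hg => intro a; exact (hg a).trans (by simpa using hf (g a))
  | inv f _ hf => intro a; simpa using (hf (f⁻¹ a)).symm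

/-- Conversely, if the transposition along every edge lies in the group, every vertex of the connected
component of `a` lies in the orbit of `a` (cf. Mathlib `swap_mem_closure_isSwap`). [folklore] -/
theorem mem_orbit_closure_of_reachable {V : Type*} [DecidableEq V] {G : SimpleGraph V}
    {S : Set (Equiv.Perm V)} (hG : ∀ x y, G.Adj x y → Equiv.swap x y ∈ Subgroup.closure S) {a b : V}
    (h : G.Reachable a b) : b ∈ MulAction.orbit (Subgroup.closure S) a := by
  obtain ⟨w⟩ := h
  induction w with
  | nil => exact MulAction.mem_orbit_self _
  | cons hadj p ih =>
    rename_i u v w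
    have hv : v ∈ MulAction.orbit (Subgroup.closure S) u :=
      MulAction.mem_orbit_iff.2 ⟨⟨Equiv.swap u v, hG u v hadj⟩, by
        rw [Subgroup.smul_def, Equiv.Perm.smul_def]; exact Equiv.swap_apply_left u v⟩
    rwa [← MulAction.orbit_eq_iff.2 hv]

/-! ### Transposition designs: membership is componentwise reachability -/

/-- **Transposition designs are switching networks.** If every `σ i` is a transposition or the
identity, then `τ` lies in the group generated by `{σ i : i ∈ U}` iff `τ` moves every point inside its
connected component of the graph on `Fin d` whose edges are the transpositions `σ i`, `i ∈ U`
(Mathlib `mem_closure_isSwap`). [folklore] -/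
theorem mem_closure_image_iff_forall_reachable : ∀ {n d : ℕ} (σ : Fin n → Equiv.Perm (Fin d)), (∀ i, σ i = 1 ∨ (σ i).IsSwap) → ∀ (U : Set (Fin n)) (τ : Equiv.Perm (Fin d)), τ ∈ Subgroup.closure (σ '' U) ↔ ∀ a, (SimpleGraph.fromRel fun a b : Fin d => ∃ i ∈ U, σ i = Equiv.swap a b).Reachable a (τ a) := by
  intro n d σ hσ U τ
  set G := SimpleGraph.fromRel fun a b : Fin d => ∃ i ∈ U, σ i = Equiv.swap a b with hGdef
  set T : Set (Equiv.Perm (Fin d)) := {f | f ∈ σ '' U ∧ f.IsSwap} with hT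
  have hcl : Subgroup.closure (σ '' U) = Subgroup.closure T := by
    apply le_antisymm
    · rw [Subgroup.closure_le]
      rintro f ⟨i, hi, rfl⟩
      rcases hσ i with h1 | hsw
      · rw [h1]
        exact one_mem _
      · exact Subgroup.subset_closure ⟨⟨i, hi, rfl⟩, hsw⟩
    · exact Subgroup.closure_mono fun f hf => hf.1
  have hTS : ∀ f ∈ T, ∃ x y, G.Adj x y ∧ f = Equiv.swap x y := by
    rintro f ⟨⟨i, hi, rfl⟩, x, y, hxy, hxyeq⟩
    refine ⟨x, y, ?_, hxyeq⟩
    rw [hGdef, SimpleGraph.fromRel_adj]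
    exact ⟨hxy, Or.inl ⟨i, hi, hxyeq⟩⟩
  have hGT : ∀ x y, G.Adj x y → Equiv.swap x y ∈ Subgroup.closure T := by
    intro x y hxy
    rw [hGdef, SimpleGraph.fromRel_adj] at hxy
    obtain ⟨hne, ⟨i, hi, he⟩ | ⟨i, hi, he⟩⟩ := hxy
    · exact Subgroup.subset_closure ⟨⟨i, hi, he⟩, x, y, hne, rfl⟩
    · rw [Equiv.swap_comm]
      exact Subgroup.subset_closure ⟨⟨i, hi, he⟩, y, x, hne.symm, rfl⟩
  rw [hcl, mem_closure_isSwap fun f hf => hf.2]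
  constructor
  · rintro ⟨-, h⟩ a
    obtain ⟨⟨f, hf⟩, hfa⟩ := MulAction.mem_orbit_iff.1 (h a)
    rw [Subgroup.smul_def, Equiv.Perm.smul_def] at hfa
    rw [← hfa]
    exact reachable_apply_of_mem_closure hTS f hf a
  · intro h
    exact ⟨Set.toFinite _, fun a => mem_orbit_closure_of_reachable hGT (h a)⟩

/-- The transposition sub-class of `PERM_s` is indeed a sub-class of `IsPermGate s`. [folklore] -/
theorem isPermGate_of_transposition {s : ℕ} {g : GateFn}
    (h : ∃ d : ℕ, d ≤ s ∧ ∃ (σ : Fin g.1 → Equiv.Perm (Fin d)) (τ : Equiv.Perm (Fin d)),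
      (∀ i, σ i = 1 ∨ (σ i).IsSwap) ∧
        ∀ v : Fin g.1 → Bool, g.2 v = true ↔ τ ∈ Subgroup.closure (σ '' {i | v i = true})) :
    IsPermGate s g := by
  obtain ⟨d, hd, σ, τ, -, hg⟩ := h
  exact ⟨d, hd, σ, τ, hg⟩

/-! ### Budget arithmetic of the transposition door -/

/-- Budget arithmetic: `2 (m^c)^4 · ε_{5c+1}(m) ≤ ε_c(m)` for `m ≥ 2` (`ε_c(m) = m^{-(c+1)}/4`). [folklore] -/
theorem two_mul_pow_mul_epsOf_le {c m : ℕ} (hm : 2 ≤ m) :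
    2 * ((m : ℝ) ^ c) ^ 4 * epsOf (5 * c + 1) m ≤ epsOf c m := by
  rw [DenseRegime.epsOf_eq, DenseRegime.epsOf_eq]
  have hm' : (2 : ℝ) ≤ m := by exact_mod_cast hm
  have hmpos : (0 : ℝ) < m := by linarith
  have e1 : ((m : ℝ) ^ c) ^ 4 = (m : ℝ) ^ (4 * c) := by rw [← pow_mul]; ring_nf
  have e2 : (m : ℝ) ^ (5 * c + 1 + 1) = (m : ℝ) ^ (4 * c) * (m : ℝ) ^ (c + 1) * m := by
    rw [← pow_add, ← pow_succ]; ring_nf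
  rw [e1, e2, mul_one_div, div_le_div_iff₀ (by positivity) (by positivity)]
  have h4 : 0 ≤ (m : ℝ) ^ (4 * c) * (m : ℝ) ^ (c + 1) := by positivity
  nlinarith [h4, mul_le_mul_of_nonneg_left hm' h4]

/-- `d⁴ + d ≤ 2 M⁴` and `d² + d³ ≤ 2 M⁴` for `d ≤ M`. [folklore] -/
theorem pow_four_add_le {d M : ℕ} (h : d ≤ M) : d ^ 4 + d ≤ 2 * M ^ 4 ∧ d ^ 2 + d ^ 3 ≤ 2 * M ^ 4 := by
  have h4 : d ^ 4 ≤ M ^ 4 := Nat.pow_le_pow_left h 4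
  have h1 : M ≤ M ^ 4 := Nat.le_self_pow (by norm_num) M
  rcases Nat.eq_zero_or_pos M with rfl | hM
  · have : d = 0 := by omega
    subst this; simp
  have h2 : d ^ 2 ≤ M ^ 4 := (Nat.pow_le_pow_left h 2).trans (Nat.pow_le_pow_right hM (by norm_num))
  have h3 : d ^ 3 ≤ M ^ 4 := (Nat.pow_le_pow_left h 3).trans (Nat.pow_le_pow_right hM (by norm_num))
  omega

end Summit.PneNP.PneNP.Theorems

end
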